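import Mathlib
import Literature.NumberTheory.LFunctions.Zhang2022.Section7dStatements
import Literature.NumberTheory.Sieve.SmoothMajorantZeta
import HarnessLib

/-!
# Zhang (2022), §7 proof of Proposition 7.1 part (c): the residue evaluations
# `i𝔯ⱼp^{−β_j} = (½, 2, 3/2)·α⁻¹ + O(𝓛)` — kernel edges from Lemma 5.4 (ii)

Topic `Literature/NumberTheory/LFunctions/Zhang2022` (Landau–Siegel audit tree; verdict-neutral).
Y. Zhang, *Discrete mean estimates and the Landau–Siegel zero*, arXiv:2211.02515v1 (2022)
[Zhang2022LandauSiegel], §7 p. 42 (tex L2168–L2177): "On the other hand, by Lemma 5.2 (ii) and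
direct calculation we have `i𝔯₁p^{−β₁} = 1/(2α) + O(𝓛)`, `i𝔯₂p^{−β₂} = 2/α + O(𝓛)`,
`i𝔯₃p^{−β₃} = 3/(2α) + O(𝓛)`" — the coefficients `½, 2, 3/2` of the main term of Proposition 7.1.

This THEOREM-ONLY file (0 new facts, D-0026) proves the three displayed claims, typed as
`Section7dStatements.Step7u058/059/060 c'` (nodes `Z22:§7.u058`–`u060`, p412033), as kernel EDGES
from the banked node `Skeleton.Lemma54` (Lemma 5.4; its part (ii) `δ(s) = 1 + O(α log 𝓛)` for
`|s − 1| < 10α` is the input the manuscript cites as "Lemma 5.2 (ii)"):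
`step7u058_of`, `step7u059_of`, `step7u060_of : Skeleton.Lemma54 → Step7u05k c'`.

The "direct calculation", made explicit: with `η = c′α𝓛`, `β₁ = iα(1−5η)`, `β₂ = iα(2+2η)`,
`β₃ = iα(3−3η)` ((2.13)), `𝔯ⱼ = ζ(1+z₂)ζ(1+z₃)δ(1−β_j)/ζ(1−β_j)` with `z₂, z₃ = β_i − β_j (i ≠ j)`;
`ζ(1+z) = 1/z + O(1)` on the punctured unit disc (tree: `CFZ.exists_bound_riemannZeta_sub_one_div`)
gives `ζ(1+z)z = 1 + O(|z|)`, `ζ(1−β_j)(−β_j) = 1 + O(α)`; for `p ∼ P` one has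
`𝓛⁹ < log p ≤ 𝓛⁹ + 1` and `α𝓛⁹ = π`, so `p^{−β_j} = (−1)^j e^{iψ_j}` with `|ψ_j| ≤ 16|η| + 4α`;
the leading terms are `i·(−β_j/(z₂z₃))·(−1)^j = T_j ρ_j` with `T = 1/(2α), 2/α, 3/(2α)` and
`|ρ_j − 1| ≤ 16|η|`; six factors within `O(α𝓛)` of `1` and `‖T_j‖ ≤ 2/α` give the `O(𝓛)` with the
explicit constant `C = 64(32|c′| + 4 + 9M + C₅₄)` (`M` the `ζ`-bound, `C₅₄` Lemma 5.4's constant),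
valid for `𝓛 ≥ 4000(|c′| + M + C₅₄ + 1)`.

WHAT THIS IS NOT: any claim about Theorems 1–2 of the manuscript or about Landau–Siegel zeros; not
a discharge of `Skeleton.Lemma54` (a separate node) nor of (7.20)/(7.10).

## References

* Y. Zhang, arXiv:2211.02515v1 (2022), §7 p. 42, tex L2168–L2177; §5 Lemma 5.4 p. 28; §2
  (2.10), (2.13). [cite: Zhang2022LandauSiegel, §7 p.42]
-/

noncomputable section

open Complex Real

namespace Literature.NumberTheory.LFunctions.Zhang2022.Section7dStatements

/-! ## The residues `𝔯ⱼ` (theorem-only; 0 new facts)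

Kernel lemmas towards `Z22:§7.u050` and `Z22:§7.u058`–`u060`: generic near-`1` bookkeeping for
products of `ζ`-values, and the parameters of §2 for `D` large. -/

section ResidueLemmas

/-- `‖xy − 1‖ ≤ 2‖x − 1‖ + ‖y − 1‖` when `‖y − 1‖ ≤ 1`. [folklore] -/
private theorem norm_mul_sub_one_le {x y : ℂ} {r s : ℝ} (hx : ‖x - 1‖ ≤ r) (hy : ‖y - 1‖ ≤ s)
    (hs : s ≤ 1) : ‖x * y - 1‖ ≤ 2 * r + s := by
  have hr : 0 ≤ r := (norm_nonneg _).trans hx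
  have hy' : ‖y‖ ≤ 2 := by
    have h := norm_add_le (y - 1) (1 : ℂ)
    rw [sub_add_cancel, norm_one] at h
    linarith
  calc ‖x * y - 1‖ = ‖(x - 1) * y + (y - 1)‖ := by ring_nf
    _ ≤ ‖(x - 1) * y‖ + ‖y - 1‖ := norm_add_le _ _
    _ = ‖x - 1‖ * ‖y‖ + ‖y - 1‖ := by rw [norm_mul]
    _ ≤ r * 2 + s := by gcongr
    _ = 2 * r + s := by ring

/-- `‖y⁻¹ − 1‖ ≤ 2‖y − 1‖` when `‖y − 1‖ ≤ 1/2`. [folklore] -/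
private theorem norm_inv_sub_one_le {y : ℂ} {s : ℝ} (hy : ‖y - 1‖ ≤ s) (hs : s ≤ 1 / 2) :
    ‖y⁻¹ - 1‖ ≤ 2 * s := by
  have h1 : 1 / 2 ≤ ‖y‖ := by
    have h := norm_sub_norm_le (1 : ℂ) y
    rw [norm_one, norm_sub_rev] at h
    linarith
  have hy0 : y ≠ 0 := by
    intro h; rw [h, norm_zero] at h1; linarith
  have heq : y⁻¹ - 1 = (1 - y) * y⁻¹ := by field_simp
  rw [heq, norm_mul, norm_inv, norm_sub_rev]
  have h2 : ‖y‖⁻¹ ≤ 2 := by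
    have := inv_anti₀ (by norm_num : (0 : ℝ) < 1 / 2) h1
    norm_num at this
    exact this
  have hs0 : 0 ≤ s := (norm_nonneg _).trans hy
  calc ‖y - 1‖ * ‖y‖⁻¹ ≤ s * 2 :=
        mul_le_mul hy h2 (inv_nonneg.mpr (norm_nonneg _)) hs0
    _ = 2 * s := by ring

/-- From `‖ζ(s) − 1/(s−1)‖ ≤ M` on the punctured unit disc: `‖ζ(1+z)z − 1‖ ≤ M‖z‖`. [folklore] -/
private theorem norm_zeta_mul_sub_one_le {M : ℝ}
    (hζ : ∀ s : ℂ, s ≠ 1 → ‖s - 1‖ ≤ 1 → ‖riemannZeta s - 1 / (s - 1)‖ ≤ M)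
    {z : ℂ} (hz : z ≠ 0) (hz1 : ‖z‖ ≤ 1) :
    ‖riemannZeta (1 + z) * z - 1‖ ≤ M * ‖z‖ := by
  have h := hζ (1 + z) (by simpa using hz) (by simpa using hz1)
  rw [add_sub_cancel_left] at h
  have heq : riemannZeta (1 + z) * z - 1 = (riemannZeta (1 + z) - 1 / z) * z := by
    rw [sub_mul, one_div, inv_mul_cancel₀ hz]
  rw [heq, norm_mul]
  exact mul_le_mul_of_nonneg_right h (norm_nonneg _)

/-- The algebraic core of the three evaluations: if `ζ(1+z₂)z₂`, `ζ(1+z₃)z₃`, `ζ(1−w)(−w)`, `δ`,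
the phase `E` and the ratio `ρ` are all within `rᵢ ≤ 1` (`r₆ ≤ 1/2` for the inverted factor) of
`1`, and `i·(−w/(z₂z₃))·σ = Tρ`, `P = σE`, then `‖i·ζ(1+z₂)ζ(1+z₃)δ/ζ(1−w)·P − T‖ ≤ 32‖T‖Σrᵢ`.
[folklore] -/
private theorem residue_core {w z₂ z₃ δv P E σ T ρ : ℂ} {r₁ r₂ r₃ r₄ r₅ r₆ : ℝ}
    (hw : w ≠ 0) (hz₂ : z₂ ≠ 0) (hz₃ : z₃ ≠ 0) (hy0 : riemannZeta (1 - w) * (-w) ≠ 0)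
    (hm : I * (-w / (z₂ * z₃)) * σ = T * ρ) (hP : P = σ * E)
    (h₁ : ‖ρ - 1‖ ≤ r₁) (h₂ : ‖E - 1‖ ≤ r₂) (h₃ : ‖riemannZeta (1 + z₂) * z₂ - 1‖ ≤ r₃)
    (h₄ : ‖riemannZeta (1 + z₃) * z₃ - 1‖ ≤ r₄) (h₅ : ‖δv - 1‖ ≤ r₅)
    (h₆ : ‖riemannZeta (1 - w) * (-w) - 1‖ ≤ r₆)
    (hr₂ : r₂ ≤ 1) (hr₃ : r₃ ≤ 1) (hr₄ : r₄ ≤ 1) (hr₅ : r₅ ≤ 1)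
    (hr₆ : r₆ ≤ 1 / 2) :
    ‖I * (riemannZeta (1 + z₂) * riemannZeta (1 + z₃) * δv / riemannZeta (1 - w)) * P - T‖ ≤
      ‖T‖ * (32 * (r₁ + r₂ + r₃ + r₄ + r₅ + r₆)) := by
  set x₂ := riemannZeta (1 + z₂) * z₂ with hx₂
  set x₃ := riemannZeta (1 + z₃) * z₃ with hx₃
  set y := riemannZeta (1 - w) * (-w) with hy
  have hζw : riemannZeta (1 - w) ≠ 0 := by
    intro h; apply hy0; rw [hy, h, zero_mul]
  have hz2 : riemannZeta (1 + z₂) = x₂ / z₂ := by rw [hx₂, mul_div_cancel_right₀ _ hz₂]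
  have hz3 : riemannZeta (1 + z₃) = x₃ / z₃ := by rw [hx₃, mul_div_cancel_right₀ _ hz₃]
  have hzw : riemannZeta (1 - w) = y / (-w) := by
    rw [hy, mul_div_cancel_right₀ _ (neg_ne_zero.mpr hw)]
  have key : I * (riemannZeta (1 + z₂) * riemannZeta (1 + z₃) * δv / riemannZeta (1 - w)) * P - T =
      T * (ρ * E * x₂ * x₃ * δv * y⁻¹ - 1) := by
    have hT : I * (-w / (z₂ * z₃)) * σ * (E * x₂ * x₃ * δv * y⁻¹) =
        T * ρ * (E * x₂ * x₃ * δv * y⁻¹) := by rw [hm]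
    rw [hz2, hz3, hzw, hP]
    have : I * (x₂ / z₂ * (x₃ / z₃) * δv / (y / -w)) * (σ * E) =
        I * (-w / (z₂ * z₃)) * σ * (E * x₂ * x₃ * δv * y⁻¹) := by
      field_simp
    rw [this, hT]
    ring
  rw [key, norm_mul]
  have hy6 : ‖y⁻¹ - 1‖ ≤ 2 * r₆ := norm_inv_sub_one_le h₆ hr₆
  have s1 : ‖ρ * E - 1‖ ≤ 2 * r₁ + r₂ := norm_mul_sub_one_le h₁ h₂ hr₂
  have s2 : ‖ρ * E * x₂ - 1‖ ≤ 2 * (2 * r₁ + r₂) + r₃ := norm_mul_sub_one_le s1 h₃ hr₃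
  have s3 : ‖ρ * E * x₂ * x₃ - 1‖ ≤ 2 * (2 * (2 * r₁ + r₂) + r₃) + r₄ :=
    norm_mul_sub_one_le s2 h₄ hr₄
  have s4 : ‖ρ * E * x₂ * x₃ * δv - 1‖ ≤ 2 * (2 * (2 * (2 * r₁ + r₂) + r₃) + r₄) + r₅ :=
    norm_mul_sub_one_le s3 h₅ hr₅
  have s5 : ‖ρ * E * x₂ * x₃ * δv * y⁻¹ - 1‖ ≤
      2 * (2 * (2 * (2 * (2 * r₁ + r₂) + r₃) + r₄) + r₅) + 2 * r₆ :=
    norm_mul_sub_one_le s4 hy6 (by linarith)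
  have hr1 : 0 ≤ r₁ := (norm_nonneg _).trans h₁
  have hr2 : 0 ≤ r₂ := (norm_nonneg _).trans h₂
  have hr3 : 0 ≤ r₃ := (norm_nonneg _).trans h₃
  have hr4 : 0 ≤ r₄ := (norm_nonneg _).trans h₄
  have hr5 : 0 ≤ r₅ := (norm_nonneg _).trans h₅
  have hr6 : 0 ≤ r₆ := (norm_nonneg _).trans h₆
  have s6 : ‖ρ * E * x₂ * x₃ * δv * y⁻¹ - 1‖ ≤ 32 * (r₁ + r₂ + r₃ + r₄ + r₅ + r₆) := by
    refine s5.trans ?_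
    nlinarith
  exact mul_le_mul_of_nonneg_left s6 (norm_nonneg _)

/-- For every `L₀` there is `D₀` with `log D ≥ max(L₀, 1)` for all `D ≥ D₀`. [folklore] -/
private theorem exists_nat_log_ge (L₀ : ℝ) :
    ∃ D₀ : ℕ, ∀ D : ℕ, D₀ ≤ D → L₀ ≤ Skeleton.ell D ∧ 1 ≤ Skeleton.ell D := by
  refine ⟨⌈Real.exp (max L₀ 1)⌉₊, fun D hD => ?_⟩
  unfold Skeleton.ell
  have h1 : Real.exp (max L₀ 1) ≤ D := (Nat.le_ceil _).trans (by exact_mod_cast hD)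
  have h2 := Real.log_le_log (Real.exp_pos _) h1
  rw [Real.log_exp] at h2
  exact ⟨(le_max_left _ _).trans h2, (le_max_right _ _).trans h2⟩

/-- `α = π/𝓛⁹` ((2.6), (2.10)). [cite: Zhang2022LandauSiegel, §2 (2.10) p.6] -/
private theorem alpha_eq (D : ℕ) : Skeleton.alpha D = π / Skeleton.ell D ^ 9 := by
  simp [Skeleton.alpha, Skeleton.bigP, Real.log_exp]

/-- For `p ∼ P`: `𝓛⁹ < log p ≤ 𝓛⁹ + 1` (the window `P < p < P(1 + 𝓛⁻⁶⁸)`, for `𝓛 ≥ 1`).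
[cite: Zhang2022LandauSiegel, §2 p.4] -/
private theorem log_mem_window {D p : ℕ} (hL : 1 ≤ Skeleton.ell D) (hp : p ∈ Skeleton.primeWindow D) :
    Skeleton.ell D ^ 9 < Real.log p ∧ Real.log p ≤ Skeleton.ell D ^ 9 + 1 := by
  unfold Skeleton.primeWindow at hp
  rw [Finset.mem_filter, Finset.mem_Ioo] at hp
  obtain ⟨⟨h1, h2⟩, hprime⟩ := hp
  have hP : 0 < Skeleton.bigP D := Real.exp_pos _
  have hPp : Skeleton.bigP D < p := (Nat.floor_lt hP.le).mp h1
  have hpU : (p : ℝ) < Skeleton.bigP D * (1 + (Skeleton.ell D ^ 68)⁻¹) := Nat.lt_ceil.mp h2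
  have hp0 : (0 : ℝ) < p := hP.trans hPp
  have hlogP : Real.log (Skeleton.bigP D) = Skeleton.ell D ^ 9 := by
    simp [Skeleton.bigP, Real.log_exp]
  constructor
  · rw [← hlogP]; exact Real.log_lt_log hP hPp
  · have hL68 : 0 < (Skeleton.ell D ^ 68)⁻¹ := by positivity
    have h3 : Real.log p < Real.log (Skeleton.bigP D * (1 + (Skeleton.ell D ^ 68)⁻¹)) :=
      Real.log_lt_log hp0 hpU
    rw [Real.log_mul hP.ne' (by positivity), hlogP] at h3
    have h4 : Real.log (1 + (Skeleton.ell D ^ 68)⁻¹) ≤ (Skeleton.ell D ^ 68)⁻¹ := by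
      have := Real.log_le_sub_one_of_pos (show (0:ℝ) < 1 + (Skeleton.ell D ^ 68)⁻¹ by positivity)
      linarith
    have h5 : (Skeleton.ell D ^ 68)⁻¹ ≤ 1 := by
      apply inv_le_one_of_one_le₀
      exact one_le_pow₀ hL
    linarith

end ResidueLemmas

section ResidueEvalOne

/-- `β_j` for `j = 1`. [cite: Zhang2022LandauSiegel, §8 p.45] -/
private theorem betaJ_one (c' : ℝ) (D : ℕ) : Skeleton.betaJ c' D 1 = Skeleton.beta1 c' D := by
  simp [Skeleton.betaJ]

/-- `β_j` for `j = 2`. [cite: Zhang2022LandauSiegel, §8 p.45] -/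
private theorem betaJ_two (c' : ℝ) (D : ℕ) : Skeleton.betaJ c' D 2 = Skeleton.beta2 c' D := by
  simp [Skeleton.betaJ]

/-- `β_j` for `j = 3`. [cite: Zhang2022LandauSiegel, §8 p.45] -/
private theorem betaJ_three (c' : ℝ) (D : ℕ) : Skeleton.betaJ c' D 3 = Skeleton.beta3 c' D := by
  simp [Skeleton.betaJ]

/-- `β₄ = β₁`. [cite: Zhang2022LandauSiegel, §8 p.45] -/
private theorem betaJ_four (c' : ℝ) (D : ℕ) : Skeleton.betaJ c' D 4 = Skeleton.beta1 c' D := by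
  simp [Skeleton.betaJ]

/-- `β₅ = β₂`. [cite: Zhang2022LandauSiegel, §8 p.45] -/
private theorem betaJ_five (c' : ℝ) (D : ℕ) : Skeleton.betaJ c' D 5 = Skeleton.beta2 c' D := by
  simp [Skeleton.betaJ]

/-- `‖i·a·r‖ = a|r|` for `a ≥ 0`. [folklore] -/
private theorem norm_I_mul_mul {a : ℝ} (ha : 0 ≤ a) (r : ℝ) :
    ‖I * (a : ℂ) * (r : ℂ)‖ = a * |r| := by
  rw [norm_mul, norm_mul, Complex.norm_I, one_mul, Complex.norm_real, Complex.norm_real,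
    Real.norm_eq_abs, Real.norm_eq_abs, abs_of_nonneg ha]

/-- `p^{−iar} = exp(−i r (π + aθ))` with `θ = log p − 𝓛⁹`, when `a𝓛⁹ = π` (`a = α`, (2.10)).
[cite: Zhang2022LandauSiegel, §2 (2.10) p.6] -/
private theorem cpow_window {p : ℕ} (hp0 : 0 < p) {a L9 : ℝ} (hπ : a * L9 = π) (r : ℝ) :
    (p : ℂ) ^ (-(I * (a : ℂ) * (r : ℂ))) =
      Complex.exp (I * ((-(r * (π + a * (Real.log p - L9))) : ℝ) : ℂ)) := by
  have hp : (p : ℂ) ≠ 0 := by exact_mod_cast hp0.ne'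
  rw [Complex.cpow_def_of_ne_zero hp, ← Complex.natCast_log]
  congr 1
  push_cast
  have : (a : ℂ) * (L9 : ℂ) = (π : ℂ) := by exact_mod_cast hπ
  linear_combination (-(I * (r : ℂ))) * this

/-- The main-term identity for `j = 1`: `i·(−β₁/((β₂−β₁)(β₃−β₁)))·(−1) = (1/(2α))·ρ₁`,
`ρ₁ = (1−5η)/((1+7η)(1+η))`. [cite: Zhang2022LandauSiegel, §7 p.42, tex L2169] -/
private theorem mainTerm_one {a η : ℝ} (ha : a ≠ 0) (h7 : 1 + 7 * η ≠ 0) (h1 : 1 + η ≠ 0) :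
    I * (-(I * (a : ℂ) * ((1 - 5 * η : ℝ) : ℂ)) /
        ((I * (a : ℂ) * ((1 + 7 * η : ℝ) : ℂ)) * (I * (a : ℂ) * ((2 + 2 * η : ℝ) : ℂ)))) * (-1) =
      (1 / (2 * (a : ℂ))) * (((1 - 5 * η) / ((1 + 7 * η) * (1 + η)) : ℝ) : ℂ) := by
  have ha' : (a : ℂ) ≠ 0 := Complex.ofReal_ne_zero.mpr ha
  have h7' : ((1 + 7 * η : ℝ) : ℂ) ≠ 0 := Complex.ofReal_ne_zero.mpr h7
  have h1' : ((1 + η : ℝ) : ℂ) ≠ 0 := Complex.ofReal_ne_zero.mpr h1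
  have h2' : ((2 + 2 * η : ℝ) : ℂ) ≠ 0 := by
    have : (2 + 2 * η : ℝ) ≠ 0 := by
      intro h; apply h1; linarith
    exact Complex.ofReal_ne_zero.mpr this
  push_cast at h7' h1' h2' ⊢
  field_simp

/-- `|ρ₁ − 1| ≤ 16|η|` for `|η| ≤ 1/1000`. [folklore] -/
private theorem rho_one_bound {η : ℝ} (hη : |η| ≤ 1 / 1000) :
    |(1 - 5 * η) / ((1 + 7 * η) * (1 + η)) - 1| ≤ 16 * |η| := by
  have h := abs_le.mp hη
  have hden : 0 < (1 + 7 * η) * (1 + η) := by nlinarith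
  rw [div_sub_one hden.ne', abs_div, abs_of_pos hden, div_le_iff₀ hden]
  have : (1 - 5 * η) - (1 + 7 * η) * (1 + η) = -(η * (13 + 7 * η)) := by ring
  rw [this, abs_neg, abs_mul, abs_of_pos (by linarith : (0:ℝ) < 13 + 7 * η)]
  have hb : 13 + 7 * η ≤ 16 * ((1 + 7 * η) * (1 + η)) := by nlinarith
  calc |η| * (13 + 7 * η) ≤ |η| * (16 * ((1 + 7 * η) * (1 + η))) :=
        mul_le_mul_of_nonneg_left hb (abs_nonneg η)
    _ = 16 * |η| * ((1 + 7 * η) * (1 + η)) := by ring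

/-- The main-term identity for `j = 2`: `i·(−β₂/((β₃−β₂)(β₁−β₂)))·1 = (2/α)·ρ₂`,
`ρ₂ = (1+η)/((1−5η)(1+7η))`. [cite: Zhang2022LandauSiegel, §7 p.42, tex L2172] -/
private theorem mainTerm_two {a η : ℝ} (ha : a ≠ 0) (h5 : 1 - 5 * η ≠ 0) (h7 : 1 + 7 * η ≠ 0) :
    I * (-(I * (a : ℂ) * ((2 + 2 * η : ℝ) : ℂ)) /
        ((I * (a : ℂ) * ((1 - 5 * η : ℝ) : ℂ)) * (I * (a : ℂ) * ((-1 - 7 * η : ℝ) : ℂ)))) * 1 =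
      (2 / (a : ℂ)) * (((1 + η) / ((1 - 5 * η) * (1 + 7 * η)) : ℝ) : ℂ) := by
  have ha' : (a : ℂ) ≠ 0 := Complex.ofReal_ne_zero.mpr ha
  have h5' : ((1 - 5 * η : ℝ) : ℂ) ≠ 0 := Complex.ofReal_ne_zero.mpr h5
  have h7' : ((1 + 7 * η : ℝ) : ℂ) ≠ 0 := Complex.ofReal_ne_zero.mpr h7
  rw [show ((-1 - 7 * η : ℝ) : ℂ) = -((1 + 7 * η : ℝ) : ℂ) by push_cast; ring]
  push_cast at h5' h7' ⊢
  field_simp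

/-- `|ρ₂ − 1| ≤ 16|η|` for `|η| ≤ 1/1000`. [folklore] -/
private theorem rho_two_bound {η : ℝ} (hη : |η| ≤ 1 / 1000) :
    |(1 + η) / ((1 - 5 * η) * (1 + 7 * η)) - 1| ≤ 16 * |η| := by
  have h := abs_le.mp hη
  have hden : 0 < (1 - 5 * η) * (1 + 7 * η) := by nlinarith
  rw [div_sub_one hden.ne', abs_div, abs_of_pos hden, div_le_iff₀ hden]
  have : (1 + η) - (1 - 5 * η) * (1 + 7 * η) = -(η * (1 - 35 * η)) := by ring
  rw [this, abs_neg, abs_mul, abs_of_pos (by linarith : (0:ℝ) < 1 - 35 * η)]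
  have hb : 1 - 35 * η ≤ 16 * ((1 - 5 * η) * (1 + 7 * η)) := by nlinarith
  calc |η| * (1 - 35 * η) ≤ |η| * (16 * ((1 - 5 * η) * (1 + 7 * η))) :=
        mul_le_mul_of_nonneg_left hb (abs_nonneg η)
    _ = 16 * |η| * ((1 - 5 * η) * (1 + 7 * η)) := by ring

/-- The main-term identity for `j = 3`: `i·(−β₃/((β₁−β₃)(β₂−β₃)))·(−1) = (3/(2α))·ρ₃`,
`ρ₃ = (1−η)/((1+η)(1−5η))`. [cite: Zhang2022LandauSiegel, §7 p.42, tex L2175] -/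
private theorem mainTerm_three {a η : ℝ} (ha : a ≠ 0) (h1 : 1 + η ≠ 0) (h5 : 1 - 5 * η ≠ 0) :
    I * (-(I * (a : ℂ) * ((3 - 3 * η : ℝ) : ℂ)) /
        ((I * (a : ℂ) * ((-2 - 2 * η : ℝ) : ℂ)) * (I * (a : ℂ) * ((-1 + 5 * η : ℝ) : ℂ)))) * (-1) =
      (3 / (2 * (a : ℂ))) * (((1 - η) / ((1 + η) * (1 - 5 * η)) : ℝ) : ℂ) := by
  have ha' : (a : ℂ) ≠ 0 := Complex.ofReal_ne_zero.mpr ha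
  have h1' : ((1 + η : ℝ) : ℂ) ≠ 0 := Complex.ofReal_ne_zero.mpr h1
  have h5' : ((1 - 5 * η : ℝ) : ℂ) ≠ 0 := Complex.ofReal_ne_zero.mpr h5
  rw [show ((-2 - 2 * η : ℝ) : ℂ) = -2 * ((1 + η : ℝ) : ℂ) by push_cast; ring,
    show ((-1 + 5 * η : ℝ) : ℂ) = -((1 - 5 * η : ℝ) : ℂ) by push_cast; ring]
  push_cast at h1' h5' ⊢
  field_simp

/-- `|ρ₃ − 1| ≤ 16|η|` for `|η| ≤ 1/1000`. [folklore] -/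
private theorem rho_three_bound {η : ℝ} (hη : |η| ≤ 1 / 1000) :
    |(1 - η) / ((1 + η) * (1 - 5 * η)) - 1| ≤ 16 * |η| := by
  have h := abs_le.mp hη
  have hden : 0 < (1 + η) * (1 - 5 * η) := by nlinarith
  rw [div_sub_one hden.ne', abs_div, abs_of_pos hden, div_le_iff₀ hden]
  have : (1 - η) - (1 + η) * (1 - 5 * η) = η * (3 + 5 * η) := by ring
  rw [this, abs_mul, abs_of_pos (by linarith : (0:ℝ) < 3 + 5 * η)]
  have hb : 3 + 5 * η ≤ 16 * ((1 + η) * (1 - 5 * η)) := by nlinarith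
  calc |η| * (3 + 5 * η) ≤ |η| * (16 * ((1 + η) * (1 - 5 * η))) :=
        mul_le_mul_of_nonneg_left hb (abs_nonneg η)
    _ = 16 * |η| * ((1 + η) * (1 - 5 * η)) := by ring

end ResidueEvalOne

section ResidueEvalMain

/-- The final numerical step shared by the three evaluations. [folklore] -/
private theorem final_bound {a L M C₅₄ c' Tn S η : ℝ} (hL : 1 ≤ L) (hM : 0 ≤ M)
    (hC : 0 ≤ C₅₄) (hT : Tn * a ≤ 2) (hTn : 0 ≤ Tn) (hη : |η| = |c'| * a * L)
    (hS : S ≤ 32 * |η| + 4 * a + 9 * (M * a) + C₅₄ * a * L) :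
    Tn * (32 * S) ≤ 64 * (32 * |c'| + 4 + 9 * M + C₅₄) * L := by
  have hc : 0 ≤ |c'| := abs_nonneg _
  have hK : 0 ≤ 32 * |c'| * L + 4 + 9 * M + C₅₄ * L := by positivity
  calc Tn * (32 * S) ≤ Tn * (32 * (a * (32 * |c'| * L + 4 + 9 * M + C₅₄ * L))) := by
        gcongr
        rw [hη] at hS
        nlinarith
    _ = (Tn * a) * (32 * (32 * |c'| * L + 4 + 9 * M + C₅₄ * L)) := by ring
    _ ≤ 2 * (32 * (32 * |c'| * L + 4 + 9 * M + C₅₄ * L)) := by gcongr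
    _ ≤ 64 * (32 * |c'| + 4 + 9 * M + C₅₄) * L := by nlinarith

variable (c' : ℝ)

/-- **`Z22:§7.u058` EDGE** (kernel): Lemma 5.4 (ii) (`Skeleton.Lemma54`, the input the manuscript
cites as "Lemma 5.2 (ii)") implies the first evaluation **`i𝔯₁p^{−β₁} = 1/(2α) + O(𝓛)`**. Proof (the
manuscript's "direct calculation"): `ζ(1+z) = 1/z + O(1)` on the punctured unit disc (tree:
`CFZ.exists_bound_riemannZeta_sub_one_div`), `δ(1−β₁) = 1 + O(α log 𝓛)`, and `p^{−β₁} =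
−(1 + O(α𝓛))` for `p ∼ P` since `α log P = π`. [cite: Zhang2022LandauSiegel, §7 p.42, tex L2169] -/
theorem step7u058_of (h54 : Skeleton.Lemma54) : Step7u058 c' := by
  -- ζ near 1
  obtain ⟨M₀, hM₀⟩ := Literature.NumberTheory.Sieve.CFZ.exists_bound_riemannZeta_sub_one_div
  obtain ⟨M, hMdef⟩ : ∃ M : ℝ, M = max M₀ 0 := ⟨_, rfl⟩
  have hM : 0 ≤ M := by rw [hMdef]; exact le_max_right _ _
  have hζ : ∀ s : ℂ, s ≠ 1 → ‖s - 1‖ ≤ 1 → ‖riemannZeta s - 1 / (s - 1)‖ ≤ M :=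
    fun s hs h1 => (hM₀ s hs h1).trans (by rw [hMdef]; exact le_max_left _ _)
  -- Lemma 5.4 (ii)
  obtain ⟨k₅₄, C₀, D₁, hD₁⟩ := h54
  obtain ⟨C₅₄, hC₅₄def⟩ : ∃ C : ℝ, C = max C₀ 0 := ⟨_, rfl⟩
  have hC₅₄ : 0 ≤ C₅₄ := by rw [hC₅₄def]; exact le_max_right _ _
  have hC₀ : C₀ ≤ C₅₄ := by rw [hC₅₄def]; exact le_max_left _ _
  -- the threshold
  obtain ⟨Q, hQdef⟩ : ∃ Q : ℝ, Q = |c'| + M + C₅₄ + 1 := ⟨_, rfl⟩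
  have hc'0 : 0 ≤ |c'| := abs_nonneg _
  have hQ1 : 1 ≤ Q := by rw [hQdef]; linarith
  have hQ0 : 0 < Q := by linarith
  have hcQ : |c'| ≤ Q := by rw [hQdef]; linarith
  have hMQ : M ≤ Q := by rw [hQdef]; linarith
  have hCQ : C₅₄ ≤ Q := by rw [hQdef]; linarith
  obtain ⟨D₂, hD₂⟩ := exists_nat_log_ge (4000 * Q)
  refine ⟨64 * (32 * |c'| + 4 + 9 * M + C₅₄), max D₁ D₂, ?_⟩
  intro D _ χ hD hq hprim _hA p hp
  -- the parameters `L = 𝓛`, `a = α`, `η = c′α𝓛`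
  obtain ⟨L, hLdef⟩ : ∃ L : ℝ, L = Skeleton.ell D := ⟨_, rfl⟩
  obtain ⟨hLQ, hL1⟩ := hD₂ D ((le_max_right _ _).trans hD)
  rw [← hLdef] at hLQ hL1
  have hL0 : 0 < L := by linarith
  obtain ⟨a, hadef⟩ : ∃ a : ℝ, a = Skeleton.alpha D := ⟨_, rfl⟩
  have ha : a = π / L ^ 9 := by rw [hadef, hLdef]; exact alpha_eq D
  have hπ0 : 0 < π := Real.pi_pos
  have hπ4 : π ≤ 4 := Real.pi_le_four
  have ha0 : 0 < a := by rw [ha]; positivity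
  have hπ : a * L ^ 9 = π := by rw [ha]; field_simp
  have hL9 : L ≤ L ^ 9 := le_self_pow₀ hL1 (by norm_num)
  have hL8 : L ≤ L ^ 8 := le_self_pow₀ hL1 (by norm_num)
  have haQ : a ≤ 1 / (1000 * Q) := by
    rw [ha]
    calc π / L ^ 9 ≤ π / L := div_le_div_of_nonneg_left hπ0.le hL0 hL9
      _ ≤ π / (4000 * Q) := div_le_div_of_nonneg_left hπ0.le (by positivity) hLQ
      _ ≤ 1 / (1000 * Q) := by
          rw [div_le_div_iff₀ (by positivity) (by positivity)]
          have h4 := mul_le_mul_of_nonneg_right hπ4 (show (0:ℝ) ≤ 1000 * Q by positivity)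
          linarith
  have haLQ : a * L ≤ 1 / (1000 * Q) := by
    have e : a * L = π / L ^ 8 := by
      rw [ha]; field_simp
    rw [e]
    calc π / L ^ 8 ≤ π / L := div_le_div_of_nonneg_left hπ0.le hL0 hL8
      _ ≤ π / (4000 * Q) := div_le_div_of_nonneg_left hπ0.le (by positivity) hLQ
      _ ≤ 1 / (1000 * Q) := by
          rw [div_le_div_iff₀ (by positivity) (by positivity)]
          have h4 := mul_le_mul_of_nonneg_right hπ4 (show (0:ℝ) ≤ 1000 * Q by positivity)
          linarith
  have hQinv : 1 / (1000 * Q) ≤ 1 / 1000 := by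
    rw [div_le_div_iff₀ (by positivity) (by positivity)]; linarith
  have ha1 : a ≤ 1 / 1000 := haQ.trans hQinv
  have haL1 : a * L ≤ 1 / 1000 := haLQ.trans hQinv
  obtain ⟨η, hηdef⟩ : ∃ η : ℝ, η = c' * a * L := ⟨_, rfl⟩
  have hηabs : |η| = |c'| * a * L := by
    rw [hηdef, abs_mul, abs_mul, abs_of_pos ha0, abs_of_pos hL0]
  have hη : |η| ≤ 1 / 1000 := by
    rw [hηabs]
    calc |c'| * a * L = |c'| * (a * L) := by ring
      _ ≤ Q * (1 / (1000 * Q)) := by gcongr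
      _ = 1 / 1000 := by field_simp
  have hMa : M * a ≤ 1 / 1000 := by
    calc M * a ≤ Q * (1 / (1000 * Q)) := by gcongr
      _ = 1 / 1000 := by field_simp
  have hCaL : C₅₄ * a * L ≤ 1 / 1000 := by
    calc C₅₄ * a * L = C₅₄ * (a * L) := by ring
      _ ≤ Q * (1 / (1000 * Q)) := by gcongr
      _ = 1 / 1000 := by field_simp
  obtain ⟨hηl, hηu⟩ := abs_le.mp hη
  -- the shifts `β₁, β₂, β₃` and `w = β₁`, `z₂ = β₂ − β₁`, `z₃ = β₃ − β₁`
  have hb1 : Skeleton.beta1 c' D = I * (a : ℂ) * ((1 - 5 * η : ℝ) : ℂ) := by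
    rw [hηdef, hadef, hLdef]; simp only [Skeleton.beta1]; push_cast; ring
  have hb2 : Skeleton.beta2 c' D = I * (a : ℂ) * ((2 + 2 * η : ℝ) : ℂ) := by
    rw [hηdef, hadef, hLdef]; simp only [Skeleton.beta2]; push_cast; ring
  have hb3 : Skeleton.beta3 c' D = I * (a : ℂ) * ((3 - 3 * η : ℝ) : ℂ) := by
    rw [hηdef, hadef, hLdef]; simp only [Skeleton.beta3]; push_cast; ring
  obtain ⟨w, hwdef⟩ : ∃ w : ℂ, w = I * (a : ℂ) * ((1 - 5 * η : ℝ) : ℂ) := ⟨_, rfl⟩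
  obtain ⟨z₂, hz₂def⟩ : ∃ z : ℂ, z = I * (a : ℂ) * ((1 + 7 * η : ℝ) : ℂ) := ⟨_, rfl⟩
  obtain ⟨z₃, hz₃def⟩ : ∃ z : ℂ, z = I * (a : ℂ) * ((2 + 2 * η : ℝ) : ℂ) := ⟨_, rfl⟩
  have hb1w : Skeleton.beta1 c' D = w := hb1.trans hwdef.symm
  have e2 : 1 - Skeleton.beta1 c' D + Skeleton.beta2 c' D = 1 + z₂ := by
    rw [hb1, hb2, hz₂def]; push_cast; ring
  have e3 : 1 - Skeleton.beta1 c' D + Skeleton.beta3 c' D = 1 + z₃ := by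
    rw [hb1, hb3, hz₃def]; push_cast; ring
  have hfr : frakr c' D 1 = riemannZeta (1 + z₂) * riemannZeta (1 + z₃) *
      Skeleton.deltaW D (1 - w) / riemannZeta (1 - w) := by
    simp only [frakr, Nat.reduceAdd, betaJ_one, betaJ_two, betaJ_three]
    rw [e2, e3, hb1w]
  -- norms of the shifts
  have hw_norm : ‖w‖ = a * |1 - 5 * η| := by rw [hwdef]; exact norm_I_mul_mul ha0.le _
  have hz₂_norm : ‖z₂‖ = a * |1 + 7 * η| := by rw [hz₂def]; exact norm_I_mul_mul ha0.le _
  have hz₃_norm : ‖z₃‖ = a * |2 + 2 * η| := by rw [hz₃def]; exact norm_I_mul_mul ha0.le _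
  have h15 : |1 - 5 * η| ≤ 2 := abs_le.mpr ⟨by linarith, by linarith⟩
  have h17 : |1 + 7 * η| ≤ 2 := abs_le.mpr ⟨by linarith, by linarith⟩
  have h22 : |2 + 2 * η| ≤ 3 := abs_le.mpr ⟨by linarith, by linarith⟩
  have hw_le : ‖w‖ ≤ 2 * a := by
    rw [hw_norm, mul_comm]; exact mul_le_mul_of_nonneg_right h15 ha0.le
  have hz₂_le : ‖z₂‖ ≤ 2 * a := by
    rw [hz₂_norm, mul_comm]; exact mul_le_mul_of_nonneg_right h17 ha0.le
  have hz₃_le : ‖z₃‖ ≤ 3 * a := by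
    rw [hz₃_norm, mul_comm]; exact mul_le_mul_of_nonneg_right h22 ha0.le
  have h15ne : (1 - 5 * η : ℝ) ≠ 0 := by intro h; linarith
  have h17ne : (1 + 7 * η : ℝ) ≠ 0 := by intro h; linarith
  have h1ne : (1 + η : ℝ) ≠ 0 := by intro h; linarith
  have h22ne : (2 + 2 * η : ℝ) ≠ 0 := by intro h; linarith
  have hIa : I * (a : ℂ) ≠ 0 := mul_ne_zero Complex.I_ne_zero (Complex.ofReal_ne_zero.mpr ha0.ne')
  have hw0 : w ≠ 0 := by rw [hwdef]; exact mul_ne_zero hIa (Complex.ofReal_ne_zero.mpr h15ne)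
  have hz₂0 : z₂ ≠ 0 := by rw [hz₂def]; exact mul_ne_zero hIa (Complex.ofReal_ne_zero.mpr h17ne)
  have hz₃0 : z₃ ≠ 0 := by rw [hz₃def]; exact mul_ne_zero hIa (Complex.ofReal_ne_zero.mpr h22ne)
  -- the three ζ-factors
  have h₃ : ‖riemannZeta (1 + z₂) * z₂ - 1‖ ≤ M * ‖z₂‖ :=
    norm_zeta_mul_sub_one_le hζ hz₂0 (by linarith)
  have h₄ : ‖riemannZeta (1 + z₃) * z₃ - 1‖ ≤ M * ‖z₃‖ :=
    norm_zeta_mul_sub_one_le hζ hz₃0 (by linarith)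
  have h₆ : ‖riemannZeta (1 - w) * (-w) - 1‖ ≤ M * ‖w‖ := by
    have h := norm_zeta_mul_sub_one_le hζ (neg_ne_zero.mpr hw0) (by rw [norm_neg]; linarith)
    rwa [← sub_eq_add_neg, norm_neg] at h
  have hMz₂ : M * ‖z₂‖ ≤ M * (2 * a) := mul_le_mul_of_nonneg_left hz₂_le hM
  have hMz₃ : M * ‖z₃‖ ≤ M * (3 * a) := mul_le_mul_of_nonneg_left hz₃_le hM
  have hMw : M * ‖w‖ ≤ M * (2 * a) := mul_le_mul_of_nonneg_left hw_le hM
  have hr₃ : M * ‖z₂‖ ≤ 1 := by linarith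
  have hr₄ : M * ‖z₃‖ ≤ 1 := by linarith
  have hr₆ : M * ‖w‖ ≤ 1 / 2 := by linarith
  have hy0 : riemannZeta (1 - w) * (-w) ≠ 0 := by
    intro h
    rw [h, zero_sub, norm_neg, norm_one] at h₆
    linarith
  -- `δ(1 − β₁)` from Lemma 5.4 (ii)
  have h54D := (hD₁ D χ ((le_max_left _ _).trans hD) hq hprim (1 - w)).2
  rw [← hadef, ← hLdef] at h54D
  have hlogL0 : 0 ≤ Real.log L := Real.log_nonneg hL1
  have h₅ : ‖Skeleton.deltaW D (1 - w) - 1‖ ≤ C₅₄ * a * Real.log L := by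
    have hlt : ‖(1 - w) - 1‖ < 10 * a := by
      rw [sub_sub_cancel_left, norm_neg]
      linarith
    refine (h54D hlt).trans ?_
    gcongr
  have hlogL : Real.log L ≤ L := (Real.log_le_sub_one_of_pos hL0).trans (by linarith)
  have hr₅ : C₅₄ * a * Real.log L ≤ 1 := by
    calc C₅₄ * a * Real.log L ≤ C₅₄ * a * L := by gcongr
      _ ≤ 1 := by linarith
  -- the phase `p^{−β₁} = −exp(iψ)`
  have hprime : p.Prime := (Finset.mem_filter.mp hp).2
  have hp0 : 0 < p := hprime.pos
  have hwin := log_mem_window (D := D) (by rw [← hLdef]; exact hL1) hp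
  rw [← hLdef] at hwin
  obtain ⟨hθ1, hθ2⟩ := hwin
  obtain ⟨θ, hθdef⟩ : ∃ θ : ℝ, θ = Real.log p - L ^ 9 := ⟨_, rfl⟩
  have hθ0 : 0 ≤ θ := by rw [hθdef]; linarith
  have hθ1' : θ ≤ 1 := by rw [hθdef]; linarith
  obtain ⟨ψ, hψdef⟩ : ∃ ψ : ℝ, ψ = π - (1 - 5 * η) * (π + a * θ) := ⟨_, rfl⟩
  have hP : (p : ℂ) ^ (-Skeleton.beta1 c' D) = (-1) * Complex.exp (I * (ψ : ℂ)) := by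
    rw [hb1, cpow_window hp0 hπ (1 - 5 * η)]
    have e : (-((1 - 5 * η) * (π + a * (Real.log p - L ^ 9))) : ℝ) = -π + ψ := by
      rw [hψdef, hθdef]; ring
    rw [e]
    push_cast
    rw [mul_add, Complex.exp_add]
    congr 1
    rw [mul_neg, mul_comm, Complex.exp_neg, Complex.exp_pi_mul_I]
    norm_num
  have hψ : |ψ| ≤ 16 * |η| + 4 * a := by
    have hπ3 : π < 3.15 := Real.pi_lt_d2
    have e : ψ = 5 * π * η - a * θ * (1 - 5 * η) := by rw [hψdef]; ring
    rw [e]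
    refine (abs_sub _ _).trans ?_
    rw [abs_mul (5 * π) η, abs_mul (a * θ) (1 - 5 * η), abs_mul a θ,
      abs_of_pos (by positivity : (0:ℝ) < 5 * π), abs_of_pos ha0, abs_of_nonneg hθ0]
    have t1 : 5 * π * |η| ≤ 16 * |η| :=
      mul_le_mul_of_nonneg_right (by linarith) (abs_nonneg η)
    have t2 : a * θ * |1 - 5 * η| ≤ a * 1 * 2 := by gcongr
    linarith
  have h₂ : ‖Complex.exp (I * (ψ : ℂ)) - 1‖ ≤ |ψ| := by
    have h := @Real.norm_exp_I_mul_ofReal_sub_one_le ψ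
    rwa [Real.norm_eq_abs] at h
  have hr₂ : |ψ| ≤ 1 := by linarith
  -- the ratio `ρ₁`
  obtain ⟨ρ, hρdef⟩ : ∃ ρ : ℝ, ρ = (1 - 5 * η) / ((1 + 7 * η) * (1 + η)) := ⟨_, rfl⟩
  have h₁ : ‖(ρ : ℂ) - 1‖ ≤ 16 * |η| := by
    rw [← Complex.ofReal_one, ← Complex.ofReal_sub, Complex.norm_real, Real.norm_eq_abs, hρdef]
    exact rho_one_bound hη
  have hm : I * (-w / (z₂ * z₃)) * (-1) = (1 / (2 * (a : ℂ))) * (ρ : ℂ) := by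
    rw [hwdef, hz₂def, hz₃def, hρdef]
    exact mainTerm_one ha0.ne' h17ne h1ne
  -- assemble
  have core := residue_core hw0 hz₂0 hz₃0 hy0 hm hP h₁ h₂ h₃ h₄ h₅ h₆ hr₂ hr₃ hr₄ hr₅ hr₆
  rw [hfr, ← hadef, ← hLdef]
  refine core.trans ?_
  have hT : ‖(1 / (2 * (a : ℂ)))‖ = 1 / (2 * a) := by
    rw [show (1 / (2 * (a : ℂ))) = ((1 / (2 * a) : ℝ) : ℂ) by push_cast; ring,
      Complex.norm_real, Real.norm_eq_abs, abs_of_pos (by positivity)]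
  rw [hT]
  refine final_bound hL1 hM hC₅₄ (by field_simp; norm_num) (by positivity) hηabs ?_
  have hMa0 : 0 ≤ M * a := mul_nonneg hM ha0.le
  calc 16 * |η| + |ψ| + M * ‖z₂‖ + M * ‖z₃‖ + C₅₄ * a * Real.log L + M * ‖w‖
      ≤ 16 * |η| + (16 * |η| + 4 * a) + M * (2 * a) + M * (3 * a) + C₅₄ * a * L +
          M * (2 * a) := by gcongr
    _ ≤ 32 * |η| + 4 * a + 9 * (M * a) + C₅₄ * a * L := by linarith

/-- **`Z22:§7.u059` EDGE** (kernel): Lemma 5.4 (ii) (`Skeleton.Lemma54`) implies the second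
evaluation **`i𝔯₂p^{−β₂} = 2/α + O(𝓛)`** (same bookkeeping as `step7u058_of`, with `p^{−β₂} =
+(1 + O(α𝓛))` since `e^{−2πi} = 1`). [cite: Zhang2022LandauSiegel, §7 p.42, tex L2172] -/
theorem step7u059_of (h54 : Skeleton.Lemma54) : Step7u059 c' := by
  -- ζ near 1
  obtain ⟨M₀, hM₀⟩ := Literature.NumberTheory.Sieve.CFZ.exists_bound_riemannZeta_sub_one_div
  obtain ⟨M, hMdef⟩ : ∃ M : ℝ, M = max M₀ 0 := ⟨_, rfl⟩
  have hM : 0 ≤ M := by rw [hMdef]; exact le_max_right _ _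
  have hζ : ∀ s : ℂ, s ≠ 1 → ‖s - 1‖ ≤ 1 → ‖riemannZeta s - 1 / (s - 1)‖ ≤ M :=
    fun s hs h1 => (hM₀ s hs h1).trans (by rw [hMdef]; exact le_max_left _ _)
  -- Lemma 5.4 (ii)
  obtain ⟨k₅₄, C₀, D₁, hD₁⟩ := h54
  obtain ⟨C₅₄, hC₅₄def⟩ : ∃ C : ℝ, C = max C₀ 0 := ⟨_, rfl⟩
  have hC₅₄ : 0 ≤ C₅₄ := by rw [hC₅₄def]; exact le_max_right _ _
  have hC₀ : C₀ ≤ C₅₄ := by rw [hC₅₄def]; exact le_max_left _ _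
  -- the threshold
  obtain ⟨Q, hQdef⟩ : ∃ Q : ℝ, Q = |c'| + M + C₅₄ + 1 := ⟨_, rfl⟩
  have hc'0 : 0 ≤ |c'| := abs_nonneg _
  have hQ1 : 1 ≤ Q := by rw [hQdef]; linarith
  have hQ0 : 0 < Q := by linarith
  have hcQ : |c'| ≤ Q := by rw [hQdef]; linarith
  have hMQ : M ≤ Q := by rw [hQdef]; linarith
  have hCQ : C₅₄ ≤ Q := by rw [hQdef]; linarith
  obtain ⟨D₂, hD₂⟩ := exists_nat_log_ge (4000 * Q)
  refine ⟨64 * (32 * |c'| + 4 + 9 * M + C₅₄), max D₁ D₂, ?_⟩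
  intro D _ χ hD hq hprim _hA p hp
  -- the parameters `L = 𝓛`, `a = α`, `η = c′α𝓛`
  obtain ⟨L, hLdef⟩ : ∃ L : ℝ, L = Skeleton.ell D := ⟨_, rfl⟩
  obtain ⟨hLQ, hL1⟩ := hD₂ D ((le_max_right _ _).trans hD)
  rw [← hLdef] at hLQ hL1
  have hL0 : 0 < L := by linarith
  obtain ⟨a, hadef⟩ : ∃ a : ℝ, a = Skeleton.alpha D := ⟨_, rfl⟩
  have ha : a = π / L ^ 9 := by rw [hadef, hLdef]; exact alpha_eq D
  have hπ0 : 0 < π := Real.pi_pos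
  have hπ4 : π ≤ 4 := Real.pi_le_four
  have ha0 : 0 < a := by rw [ha]; positivity
  have hπ : a * L ^ 9 = π := by rw [ha]; field_simp
  have hL9 : L ≤ L ^ 9 := le_self_pow₀ hL1 (by norm_num)
  have hL8 : L ≤ L ^ 8 := le_self_pow₀ hL1 (by norm_num)
  have haQ : a ≤ 1 / (1000 * Q) := by
    rw [ha]
    calc π / L ^ 9 ≤ π / L := div_le_div_of_nonneg_left hπ0.le hL0 hL9
      _ ≤ π / (4000 * Q) := div_le_div_of_nonneg_left hπ0.le (by positivity) hLQ
      _ ≤ 1 / (1000 * Q) := by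
          rw [div_le_div_iff₀ (by positivity) (by positivity)]
          have h4 := mul_le_mul_of_nonneg_right hπ4 (show (0:ℝ) ≤ 1000 * Q by positivity)
          linarith
  have haLQ : a * L ≤ 1 / (1000 * Q) := by
    have e : a * L = π / L ^ 8 := by
      rw [ha]; field_simp
    rw [e]
    calc π / L ^ 8 ≤ π / L := div_le_div_of_nonneg_left hπ0.le hL0 hL8
      _ ≤ π / (4000 * Q) := div_le_div_of_nonneg_left hπ0.le (by positivity) hLQ
      _ ≤ 1 / (1000 * Q) := by
          rw [div_le_div_iff₀ (by positivity) (by positivity)]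
          have h4 := mul_le_mul_of_nonneg_right hπ4 (show (0:ℝ) ≤ 1000 * Q by positivity)
          linarith
  have hQinv : 1 / (1000 * Q) ≤ 1 / 1000 := by
    rw [div_le_div_iff₀ (by positivity) (by positivity)]; linarith
  have ha1 : a ≤ 1 / 1000 := haQ.trans hQinv
  have haL1 : a * L ≤ 1 / 1000 := haLQ.trans hQinv
  obtain ⟨η, hηdef⟩ : ∃ η : ℝ, η = c' * a * L := ⟨_, rfl⟩
  have hηabs : |η| = |c'| * a * L := by
    rw [hηdef, abs_mul, abs_mul, abs_of_pos ha0, abs_of_pos hL0]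
  have hη : |η| ≤ 1 / 1000 := by
    rw [hηabs]
    calc |c'| * a * L = |c'| * (a * L) := by ring
      _ ≤ Q * (1 / (1000 * Q)) := by gcongr
      _ = 1 / 1000 := by field_simp
  have hMa : M * a ≤ 1 / 1000 := by
    calc M * a ≤ Q * (1 / (1000 * Q)) := by gcongr
      _ = 1 / 1000 := by field_simp
  have hCaL : C₅₄ * a * L ≤ 1 / 1000 := by
    calc C₅₄ * a * L = C₅₄ * (a * L) := by ring
      _ ≤ Q * (1 / (1000 * Q)) := by gcongr
      _ = 1 / 1000 := by field_simp
  obtain ⟨hηl, hηu⟩ := abs_le.mp hη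
  -- the shifts `β₁, β₂, β₃` and `w = β₂`, `z₂ = β₃ − β₂`, `z₃ = β₁ − β₂`
  have hb1 : Skeleton.beta1 c' D = I * (a : ℂ) * ((1 - 5 * η : ℝ) : ℂ) := by
    rw [hηdef, hadef, hLdef]; simp only [Skeleton.beta1]; push_cast; ring
  have hb2 : Skeleton.beta2 c' D = I * (a : ℂ) * ((2 + 2 * η : ℝ) : ℂ) := by
    rw [hηdef, hadef, hLdef]; simp only [Skeleton.beta2]; push_cast; ring
  have hb3 : Skeleton.beta3 c' D = I * (a : ℂ) * ((3 - 3 * η : ℝ) : ℂ) := by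
    rw [hηdef, hadef, hLdef]; simp only [Skeleton.beta3]; push_cast; ring
  obtain ⟨w, hwdef⟩ : ∃ w : ℂ, w = I * (a : ℂ) * ((2 + 2 * η : ℝ) : ℂ) := ⟨_, rfl⟩
  obtain ⟨z₂, hz₂def⟩ : ∃ z : ℂ, z = I * (a : ℂ) * ((1 - 5 * η : ℝ) : ℂ) := ⟨_, rfl⟩
  obtain ⟨z₃, hz₃def⟩ : ∃ z : ℂ, z = I * (a : ℂ) * ((-1 - 7 * η : ℝ) : ℂ) := ⟨_, rfl⟩
  have hb2w : Skeleton.beta2 c' D = w := hb2.trans hwdef.symm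
  have e2 : 1 - Skeleton.beta2 c' D + Skeleton.beta3 c' D = 1 + z₂ := by
    rw [hb2, hb3, hz₂def]; push_cast; ring
  have e3 : 1 - Skeleton.beta2 c' D + Skeleton.beta1 c' D = 1 + z₃ := by
    rw [hb2, hb1, hz₃def]; push_cast; ring
  have hfr : frakr c' D 2 = riemannZeta (1 + z₂) * riemannZeta (1 + z₃) *
      Skeleton.deltaW D (1 - w) / riemannZeta (1 - w) := by
    simp only [frakr, Nat.reduceAdd, betaJ_two, betaJ_three, betaJ_four]
    rw [e2, e3, hb2w]
  -- norms of the shifts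
  have hw_norm : ‖w‖ = a * |2 + 2 * η| := by rw [hwdef]; exact norm_I_mul_mul ha0.le _
  have hz₂_norm : ‖z₂‖ = a * |1 - 5 * η| := by rw [hz₂def]; exact norm_I_mul_mul ha0.le _
  have hz₃_norm : ‖z₃‖ = a * |-1 - 7 * η| := by rw [hz₃def]; exact norm_I_mul_mul ha0.le _
  have h22 : |2 + 2 * η| ≤ 3 := abs_le.mpr ⟨by linarith, by linarith⟩
  have h15 : |1 - 5 * η| ≤ 2 := abs_le.mpr ⟨by linarith, by linarith⟩
  have h17 : |-1 - 7 * η| ≤ 2 := abs_le.mpr ⟨by linarith, by linarith⟩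
  have hw_le : ‖w‖ ≤ 3 * a := by
    rw [hw_norm, mul_comm]; exact mul_le_mul_of_nonneg_right h22 ha0.le
  have hz₂_le : ‖z₂‖ ≤ 2 * a := by
    rw [hz₂_norm, mul_comm]; exact mul_le_mul_of_nonneg_right h15 ha0.le
  have hz₃_le : ‖z₃‖ ≤ 2 * a := by
    rw [hz₃_norm, mul_comm]; exact mul_le_mul_of_nonneg_right h17 ha0.le
  have h15ne : (1 - 5 * η : ℝ) ≠ 0 := by intro h; linarith
  have h17ne : (1 + 7 * η : ℝ) ≠ 0 := by intro h; linarith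
  have h17ne' : (-1 - 7 * η : ℝ) ≠ 0 := by intro h; linarith
  have h22ne : (2 + 2 * η : ℝ) ≠ 0 := by intro h; linarith
  have hIa : I * (a : ℂ) ≠ 0 := mul_ne_zero Complex.I_ne_zero (Complex.ofReal_ne_zero.mpr ha0.ne')
  have hw0 : w ≠ 0 := by rw [hwdef]; exact mul_ne_zero hIa (Complex.ofReal_ne_zero.mpr h22ne)
  have hz₂0 : z₂ ≠ 0 := by rw [hz₂def]; exact mul_ne_zero hIa (Complex.ofReal_ne_zero.mpr h15ne)
  have hz₃0 : z₃ ≠ 0 := by rw [hz₃def]; exact mul_ne_zero hIa (Complex.ofReal_ne_zero.mpr h17ne')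
  -- the three ζ-factors
  have h₃ : ‖riemannZeta (1 + z₂) * z₂ - 1‖ ≤ M * ‖z₂‖ :=
    norm_zeta_mul_sub_one_le hζ hz₂0 (by linarith)
  have h₄ : ‖riemannZeta (1 + z₃) * z₃ - 1‖ ≤ M * ‖z₃‖ :=
    norm_zeta_mul_sub_one_le hζ hz₃0 (by linarith)
  have h₆ : ‖riemannZeta (1 - w) * (-w) - 1‖ ≤ M * ‖w‖ := by
    have h := norm_zeta_mul_sub_one_le hζ (neg_ne_zero.mpr hw0) (by rw [norm_neg]; linarith)
    rwa [← sub_eq_add_neg, norm_neg] at h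
  have hMz₂ : M * ‖z₂‖ ≤ M * (2 * a) := mul_le_mul_of_nonneg_left hz₂_le hM
  have hMz₃ : M * ‖z₃‖ ≤ M * (2 * a) := mul_le_mul_of_nonneg_left hz₃_le hM
  have hMw : M * ‖w‖ ≤ M * (3 * a) := mul_le_mul_of_nonneg_left hw_le hM
  have hr₃ : M * ‖z₂‖ ≤ 1 := by linarith
  have hr₄ : M * ‖z₃‖ ≤ 1 := by linarith
  have hr₆ : M * ‖w‖ ≤ 1 / 2 := by linarith
  have hy0 : riemannZeta (1 - w) * (-w) ≠ 0 := by
    intro h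
    rw [h, zero_sub, norm_neg, norm_one] at h₆
    linarith
  -- `δ(1 − β₂)` from Lemma 5.4 (ii)
  have h54D := (hD₁ D χ ((le_max_left _ _).trans hD) hq hprim (1 - w)).2
  rw [← hadef, ← hLdef] at h54D
  have hlogL0 : 0 ≤ Real.log L := Real.log_nonneg hL1
  have h₅ : ‖Skeleton.deltaW D (1 - w) - 1‖ ≤ C₅₄ * a * Real.log L := by
    have hlt : ‖(1 - w) - 1‖ < 10 * a := by
      rw [sub_sub_cancel_left, norm_neg]
      linarith
    refine (h54D hlt).trans ?_
    gcongr
  have hlogL : Real.log L ≤ L := (Real.log_le_sub_one_of_pos hL0).trans (by linarith)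
  have hr₅ : C₅₄ * a * Real.log L ≤ 1 := by
    calc C₅₄ * a * Real.log L ≤ C₅₄ * a * L := by gcongr
      _ ≤ 1 := by linarith
  -- the phase `p^{−β₂} = exp(iψ)`
  have hprime : p.Prime := (Finset.mem_filter.mp hp).2
  have hp0 : 0 < p := hprime.pos
  have hwin := log_mem_window (D := D) (by rw [← hLdef]; exact hL1) hp
  rw [← hLdef] at hwin
  obtain ⟨hθ1, hθ2⟩ := hwin
  obtain ⟨θ, hθdef⟩ : ∃ θ : ℝ, θ = Real.log p - L ^ 9 := ⟨_, rfl⟩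
  have hθ0 : 0 ≤ θ := by rw [hθdef]; linarith
  have hθ1' : θ ≤ 1 := by rw [hθdef]; linarith
  obtain ⟨ψ, hψdef⟩ : ∃ ψ : ℝ, ψ = 2 * π - (2 + 2 * η) * (π + a * θ) := ⟨_, rfl⟩
  have hP : (p : ℂ) ^ (-Skeleton.beta2 c' D) = 1 * Complex.exp (I * (ψ : ℂ)) := by
    rw [hb2, cpow_window hp0 hπ (2 + 2 * η)]
    have e : (-((2 + 2 * η) * (π + a * (Real.log p - L ^ 9))) : ℝ) = -(2 * π) + ψ := by
      rw [hψdef, hθdef]; ring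
    rw [e]
    push_cast
    rw [mul_add, Complex.exp_add]
    congr 1
    rw [show I * -(2 * (π : ℂ)) = -(2 * π * I) by ring, Complex.exp_neg, Complex.exp_two_pi_mul_I,
      inv_one]
  have hψ : |ψ| ≤ 16 * |η| + 4 * a := by
    have hπ3 : π < 3.15 := Real.pi_lt_d2
    have e : ψ = -(2 * π) * η - a * θ * (2 + 2 * η) := by rw [hψdef]; ring
    rw [e]
    refine (abs_sub _ _).trans ?_
    rw [abs_mul (-(2 * π)) η, abs_mul (a * θ) (2 + 2 * η), abs_mul a θ, abs_neg,
      abs_of_pos (by positivity : (0:ℝ) < 2 * π), abs_of_pos ha0, abs_of_nonneg hθ0]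
    have t1 : 2 * π * |η| ≤ 16 * |η| :=
      mul_le_mul_of_nonneg_right (by linarith) (abs_nonneg η)
    have t2 : a * θ * |2 + 2 * η| ≤ a * 1 * 3 := by gcongr
    linarith
  have h₂ : ‖Complex.exp (I * (ψ : ℂ)) - 1‖ ≤ |ψ| := by
    have h := @Real.norm_exp_I_mul_ofReal_sub_one_le ψ
    rwa [Real.norm_eq_abs] at h
  have hr₂ : |ψ| ≤ 1 := by linarith
  -- the ratio `ρ₂`
  obtain ⟨ρ, hρdef⟩ : ∃ ρ : ℝ, ρ = (1 + η) / ((1 - 5 * η) * (1 + 7 * η)) := ⟨_, rfl⟩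
  have h₁ : ‖(ρ : ℂ) - 1‖ ≤ 16 * |η| := by
    rw [← Complex.ofReal_one, ← Complex.ofReal_sub, Complex.norm_real, Real.norm_eq_abs, hρdef]
    exact rho_two_bound hη
  have hm : I * (-w / (z₂ * z₃)) * 1 = (2 / (a : ℂ)) * (ρ : ℂ) := by
    rw [hwdef, hz₂def, hz₃def, hρdef]
    exact mainTerm_two ha0.ne' h15ne h17ne
  -- assemble
  have core := residue_core hw0 hz₂0 hz₃0 hy0 hm hP h₁ h₂ h₃ h₄ h₅ h₆ hr₂ hr₃ hr₄ hr₅ hr₆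
  rw [hfr, ← hadef, ← hLdef]
  refine core.trans ?_
  have hT : ‖(2 / (a : ℂ))‖ = 2 / a := by
    rw [show (2 / (a : ℂ)) = ((2 / a : ℝ) : ℂ) by push_cast; ring,
      Complex.norm_real, Real.norm_eq_abs, abs_of_pos (by positivity)]
  rw [hT]
  refine final_bound hL1 hM hC₅₄ (by field_simp; norm_num) (by positivity) hηabs ?_
  have hMa0 : 0 ≤ M * a := mul_nonneg hM ha0.le
  calc 16 * |η| + |ψ| + M * ‖z₂‖ + M * ‖z₃‖ + C₅₄ * a * Real.log L + M * ‖w‖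
      ≤ 16 * |η| + (16 * |η| + 4 * a) + M * (2 * a) + M * (2 * a) + C₅₄ * a * L +
          M * (3 * a) := by gcongr
    _ ≤ 32 * |η| + 4 * a + 9 * (M * a) + C₅₄ * a * L := by linarith

/-- **`Z22:§7.u060` EDGE** (kernel): Lemma 5.4 (ii) (`Skeleton.Lemma54`) implies the third
evaluation **`i𝔯₃p^{−β₃} = 3/(2α) + O(𝓛)`** (same bookkeeping as `step7u058_of`, with `p^{−β₃} =
−(1 + O(α𝓛))` since `e^{−3πi} = −1`). [cite: Zhang2022LandauSiegel, §7 p.42, tex L2175] -/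
theorem step7u060_of (h54 : Skeleton.Lemma54) : Step7u060 c' := by
  -- ζ near 1
  obtain ⟨M₀, hM₀⟩ := Literature.NumberTheory.Sieve.CFZ.exists_bound_riemannZeta_sub_one_div
  obtain ⟨M, hMdef⟩ : ∃ M : ℝ, M = max M₀ 0 := ⟨_, rfl⟩
  have hM : 0 ≤ M := by rw [hMdef]; exact le_max_right _ _
  have hζ : ∀ s : ℂ, s ≠ 1 → ‖s - 1‖ ≤ 1 → ‖riemannZeta s - 1 / (s - 1)‖ ≤ M :=
    fun s hs h1 => (hM₀ s hs h1).trans (by rw [hMdef]; exact le_max_left _ _)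
  -- Lemma 5.4 (ii)
  obtain ⟨k₅₄, C₀, D₁, hD₁⟩ := h54
  obtain ⟨C₅₄, hC₅₄def⟩ : ∃ C : ℝ, C = max C₀ 0 := ⟨_, rfl⟩
  have hC₅₄ : 0 ≤ C₅₄ := by rw [hC₅₄def]; exact le_max_right _ _
  have hC₀ : C₀ ≤ C₅₄ := by rw [hC₅₄def]; exact le_max_left _ _
  -- the threshold
  obtain ⟨Q, hQdef⟩ : ∃ Q : ℝ, Q = |c'| + M + C₅₄ + 1 := ⟨_, rfl⟩
  have hc'0 : 0 ≤ |c'| := abs_nonneg _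
  have hQ1 : 1 ≤ Q := by rw [hQdef]; linarith
  have hQ0 : 0 < Q := by linarith
  have hcQ : |c'| ≤ Q := by rw [hQdef]; linarith
  have hMQ : M ≤ Q := by rw [hQdef]; linarith
  have hCQ : C₅₄ ≤ Q := by rw [hQdef]; linarith
  obtain ⟨D₂, hD₂⟩ := exists_nat_log_ge (4000 * Q)
  refine ⟨64 * (32 * |c'| + 4 + 9 * M + C₅₄), max D₁ D₂, ?_⟩
  intro D _ χ hD hq hprim _hA p hp
  -- the parameters `L = 𝓛`, `a = α`, `η = c′α𝓛`
  obtain ⟨L, hLdef⟩ : ∃ L : ℝ, L = Skeleton.ell D := ⟨_, rfl⟩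
  obtain ⟨hLQ, hL1⟩ := hD₂ D ((le_max_right _ _).trans hD)
  rw [← hLdef] at hLQ hL1
  have hL0 : 0 < L := by linarith
  obtain ⟨a, hadef⟩ : ∃ a : ℝ, a = Skeleton.alpha D := ⟨_, rfl⟩
  have ha : a = π / L ^ 9 := by rw [hadef, hLdef]; exact alpha_eq D
  have hπ0 : 0 < π := Real.pi_pos
  have hπ4 : π ≤ 4 := Real.pi_le_four
  have ha0 : 0 < a := by rw [ha]; positivity
  have hπ : a * L ^ 9 = π := by rw [ha]; field_simp
  have hL9 : L ≤ L ^ 9 := le_self_pow₀ hL1 (by norm_num)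
  have hL8 : L ≤ L ^ 8 := le_self_pow₀ hL1 (by norm_num)
  have haQ : a ≤ 1 / (1000 * Q) := by
    rw [ha]
    calc π / L ^ 9 ≤ π / L := div_le_div_of_nonneg_left hπ0.le hL0 hL9
      _ ≤ π / (4000 * Q) := div_le_div_of_nonneg_left hπ0.le (by positivity) hLQ
      _ ≤ 1 / (1000 * Q) := by
          rw [div_le_div_iff₀ (by positivity) (by positivity)]
          have h4 := mul_le_mul_of_nonneg_right hπ4 (show (0:ℝ) ≤ 1000 * Q by positivity)
          linarith
  have haLQ : a * L ≤ 1 / (1000 * Q) := by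
    have e : a * L = π / L ^ 8 := by
      rw [ha]; field_simp
    rw [e]
    calc π / L ^ 8 ≤ π / L := div_le_div_of_nonneg_left hπ0.le hL0 hL8
      _ ≤ π / (4000 * Q) := div_le_div_of_nonneg_left hπ0.le (by positivity) hLQ
      _ ≤ 1 / (1000 * Q) := by
          rw [div_le_div_iff₀ (by positivity) (by positivity)]
          have h4 := mul_le_mul_of_nonneg_right hπ4 (show (0:ℝ) ≤ 1000 * Q by positivity)
          linarith
  have hQinv : 1 / (1000 * Q) ≤ 1 / 1000 := by
    rw [div_le_div_iff₀ (by positivity) (by positivity)]; linarith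
  have ha1 : a ≤ 1 / 1000 := haQ.trans hQinv
  have haL1 : a * L ≤ 1 / 1000 := haLQ.trans hQinv
  obtain ⟨η, hηdef⟩ : ∃ η : ℝ, η = c' * a * L := ⟨_, rfl⟩
  have hηabs : |η| = |c'| * a * L := by
    rw [hηdef, abs_mul, abs_mul, abs_of_pos ha0, abs_of_pos hL0]
  have hη : |η| ≤ 1 / 1000 := by
    rw [hηabs]
    calc |c'| * a * L = |c'| * (a * L) := by ring
      _ ≤ Q * (1 / (1000 * Q)) := by gcongr
      _ = 1 / 1000 := by field_simp
  have hMa : M * a ≤ 1 / 1000 := by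
    calc M * a ≤ Q * (1 / (1000 * Q)) := by gcongr
      _ = 1 / 1000 := by field_simp
  have hCaL : C₅₄ * a * L ≤ 1 / 1000 := by
    calc C₅₄ * a * L = C₅₄ * (a * L) := by ring
      _ ≤ Q * (1 / (1000 * Q)) := by gcongr
      _ = 1 / 1000 := by field_simp
  obtain ⟨hηl, hηu⟩ := abs_le.mp hη
  -- the shifts `β₁, β₂, β₃` and `w = β₃`, `z₂ = β₁ − β₃`, `z₃ = β₂ − β₃`
  have hb1 : Skeleton.beta1 c' D = I * (a : ℂ) * ((1 - 5 * η : ℝ) : ℂ) := by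
    rw [hηdef, hadef, hLdef]; simp only [Skeleton.beta1]; push_cast; ring
  have hb2 : Skeleton.beta2 c' D = I * (a : ℂ) * ((2 + 2 * η : ℝ) : ℂ) := by
    rw [hηdef, hadef, hLdef]; simp only [Skeleton.beta2]; push_cast; ring
  have hb3 : Skeleton.beta3 c' D = I * (a : ℂ) * ((3 - 3 * η : ℝ) : ℂ) := by
    rw [hηdef, hadef, hLdef]; simp only [Skeleton.beta3]; push_cast; ring
  obtain ⟨w, hwdef⟩ : ∃ w : ℂ, w = I * (a : ℂ) * ((3 - 3 * η : ℝ) : ℂ) := ⟨_, rfl⟩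
  obtain ⟨z₂, hz₂def⟩ : ∃ z : ℂ, z = I * (a : ℂ) * ((-2 - 2 * η : ℝ) : ℂ) := ⟨_, rfl⟩
  obtain ⟨z₃, hz₃def⟩ : ∃ z : ℂ, z = I * (a : ℂ) * ((-1 + 5 * η : ℝ) : ℂ) := ⟨_, rfl⟩
  have hb3w : Skeleton.beta3 c' D = w := hb3.trans hwdef.symm
  have e2 : 1 - Skeleton.beta3 c' D + Skeleton.beta1 c' D = 1 + z₂ := by
    rw [hb3, hb1, hz₂def]; push_cast; ring
  have e3 : 1 - Skeleton.beta3 c' D + Skeleton.beta2 c' D = 1 + z₃ := by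
    rw [hb3, hb2, hz₃def]; push_cast; ring
  have hfr : frakr c' D 3 = riemannZeta (1 + z₂) * riemannZeta (1 + z₃) *
      Skeleton.deltaW D (1 - w) / riemannZeta (1 - w) := by
    simp only [frakr, Nat.reduceAdd, betaJ_three, betaJ_four, betaJ_five]
    rw [e2, e3, hb3w]
  -- norms of the shifts
  have hw_norm : ‖w‖ = a * |3 - 3 * η| := by rw [hwdef]; exact norm_I_mul_mul ha0.le _
  have hz₂_norm : ‖z₂‖ = a * |-2 - 2 * η| := by rw [hz₂def]; exact norm_I_mul_mul ha0.le _
  have hz₃_norm : ‖z₃‖ = a * |-1 + 5 * η| := by rw [hz₃def]; exact norm_I_mul_mul ha0.le _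
  have h33 : |3 - 3 * η| ≤ 4 := abs_le.mpr ⟨by linarith, by linarith⟩
  have h22 : |-2 - 2 * η| ≤ 3 := abs_le.mpr ⟨by linarith, by linarith⟩
  have h15 : |-1 + 5 * η| ≤ 2 := abs_le.mpr ⟨by linarith, by linarith⟩
  have hw_le : ‖w‖ ≤ 4 * a := by
    rw [hw_norm, mul_comm]; exact mul_le_mul_of_nonneg_right h33 ha0.le
  have hz₂_le : ‖z₂‖ ≤ 3 * a := by
    rw [hz₂_norm, mul_comm]; exact mul_le_mul_of_nonneg_right h22 ha0.le
  have hz₃_le : ‖z₃‖ ≤ 2 * a := by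
    rw [hz₃_norm, mul_comm]; exact mul_le_mul_of_nonneg_right h15 ha0.le
  have h33ne : (3 - 3 * η : ℝ) ≠ 0 := by intro h; linarith
  have h22ne : (-2 - 2 * η : ℝ) ≠ 0 := by intro h; linarith
  have h15ne : (1 - 5 * η : ℝ) ≠ 0 := by intro h; linarith
  have h15ne' : (-1 + 5 * η : ℝ) ≠ 0 := by intro h; linarith
  have h1ne : (1 + η : ℝ) ≠ 0 := by intro h; linarith
  have hIa : I * (a : ℂ) ≠ 0 := mul_ne_zero Complex.I_ne_zero (Complex.ofReal_ne_zero.mpr ha0.ne')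
  have hw0 : w ≠ 0 := by rw [hwdef]; exact mul_ne_zero hIa (Complex.ofReal_ne_zero.mpr h33ne)
  have hz₂0 : z₂ ≠ 0 := by rw [hz₂def]; exact mul_ne_zero hIa (Complex.ofReal_ne_zero.mpr h22ne)
  have hz₃0 : z₃ ≠ 0 := by rw [hz₃def]; exact mul_ne_zero hIa (Complex.ofReal_ne_zero.mpr h15ne')
  -- the three ζ-factors
  have h₃ : ‖riemannZeta (1 + z₂) * z₂ - 1‖ ≤ M * ‖z₂‖ :=
    norm_zeta_mul_sub_one_le hζ hz₂0 (by linarith)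
  have h₄ : ‖riemannZeta (1 + z₃) * z₃ - 1‖ ≤ M * ‖z₃‖ :=
    norm_zeta_mul_sub_one_le hζ hz₃0 (by linarith)
  have h₆ : ‖riemannZeta (1 - w) * (-w) - 1‖ ≤ M * ‖w‖ := by
    have h := norm_zeta_mul_sub_one_le hζ (neg_ne_zero.mpr hw0) (by rw [norm_neg]; linarith)
    rwa [← sub_eq_add_neg, norm_neg] at h
  have hMz₂ : M * ‖z₂‖ ≤ M * (3 * a) := mul_le_mul_of_nonneg_left hz₂_le hM
  have hMz₃ : M * ‖z₃‖ ≤ M * (2 * a) := mul_le_mul_of_nonneg_left hz₃_le hM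
  have hMw : M * ‖w‖ ≤ M * (4 * a) := mul_le_mul_of_nonneg_left hw_le hM
  have hr₃ : M * ‖z₂‖ ≤ 1 := by linarith
  have hr₄ : M * ‖z₃‖ ≤ 1 := by linarith
  have hr₆ : M * ‖w‖ ≤ 1 / 2 := by linarith
  have hy0 : riemannZeta (1 - w) * (-w) ≠ 0 := by
    intro h
    rw [h, zero_sub, norm_neg, norm_one] at h₆
    linarith
  -- `δ(1 − β₃)` from Lemma 5.4 (ii)
  have h54D := (hD₁ D χ ((le_max_left _ _).trans hD) hq hprim (1 - w)).2
  rw [← hadef, ← hLdef] at h54D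
  have hlogL0 : 0 ≤ Real.log L := Real.log_nonneg hL1
  have h₅ : ‖Skeleton.deltaW D (1 - w) - 1‖ ≤ C₅₄ * a * Real.log L := by
    have hlt : ‖(1 - w) - 1‖ < 10 * a := by
      rw [sub_sub_cancel_left, norm_neg]
      linarith
    refine (h54D hlt).trans ?_
    gcongr
  have hlogL : Real.log L ≤ L := (Real.log_le_sub_one_of_pos hL0).trans (by linarith)
  have hr₅ : C₅₄ * a * Real.log L ≤ 1 := by
    calc C₅₄ * a * Real.log L ≤ C₅₄ * a * L := by gcongr
      _ ≤ 1 := by linarith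
  -- the phase `p^{−β₃} = −exp(iψ)`
  have hprime : p.Prime := (Finset.mem_filter.mp hp).2
  have hp0 : 0 < p := hprime.pos
  have hwin := log_mem_window (D := D) (by rw [← hLdef]; exact hL1) hp
  rw [← hLdef] at hwin
  obtain ⟨hθ1, hθ2⟩ := hwin
  obtain ⟨θ, hθdef⟩ : ∃ θ : ℝ, θ = Real.log p - L ^ 9 := ⟨_, rfl⟩
  have hθ0 : 0 ≤ θ := by rw [hθdef]; linarith
  have hθ1' : θ ≤ 1 := by rw [hθdef]; linarith
  obtain ⟨ψ, hψdef⟩ : ∃ ψ : ℝ, ψ = 3 * π - (3 - 3 * η) * (π + a * θ) := ⟨_, rfl⟩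
  have hP : (p : ℂ) ^ (-Skeleton.beta3 c' D) = (-1) * Complex.exp (I * (ψ : ℂ)) := by
    rw [hb3, cpow_window hp0 hπ (3 - 3 * η)]
    have e : (-((3 - 3 * η) * (π + a * (Real.log p - L ^ 9))) : ℝ) = -(3 * π) + ψ := by
      rw [hψdef, hθdef]; ring
    rw [e]
    push_cast
    rw [mul_add, Complex.exp_add]
    congr 1
    rw [show I * -(3 * (π : ℂ)) = -(π * I) + -(2 * π * I) by ring, Complex.exp_add,
      Complex.exp_neg, Complex.exp_neg, Complex.exp_pi_mul_I, Complex.exp_two_pi_mul_I]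
    norm_num
  have hψ : |ψ| ≤ 16 * |η| + 4 * a := by
    have hπ3 : π < 3.15 := Real.pi_lt_d2
    have e : ψ = 3 * π * η - a * θ * (3 - 3 * η) := by rw [hψdef]; ring
    rw [e]
    refine (abs_sub _ _).trans ?_
    rw [abs_mul (3 * π) η, abs_mul (a * θ) (3 - 3 * η), abs_mul a θ,
      abs_of_pos (by positivity : (0:ℝ) < 3 * π), abs_of_pos ha0, abs_of_nonneg hθ0]
    have t1 : 3 * π * |η| ≤ 16 * |η| :=
      mul_le_mul_of_nonneg_right (by linarith) (abs_nonneg η)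
    have t2 : a * θ * |3 - 3 * η| ≤ a * 1 * 4 := by gcongr
    linarith
  have h₂ : ‖Complex.exp (I * (ψ : ℂ)) - 1‖ ≤ |ψ| := by
    have h := @Real.norm_exp_I_mul_ofReal_sub_one_le ψ
    rwa [Real.norm_eq_abs] at h
  have hr₂ : |ψ| ≤ 1 := by linarith
  -- the ratio `ρ₃`
  obtain ⟨ρ, hρdef⟩ : ∃ ρ : ℝ, ρ = (1 - η) / ((1 + η) * (1 - 5 * η)) := ⟨_, rfl⟩
  have h₁ : ‖(ρ : ℂ) - 1‖ ≤ 16 * |η| := by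
    rw [← Complex.ofReal_one, ← Complex.ofReal_sub, Complex.norm_real, Real.norm_eq_abs, hρdef]
    exact rho_three_bound hη
  have hm : I * (-w / (z₂ * z₃)) * (-1) = (3 / (2 * (a : ℂ))) * (ρ : ℂ) := by
    rw [hwdef, hz₂def, hz₃def, hρdef]
    exact mainTerm_three ha0.ne' h1ne h15ne
  -- assemble
  have core := residue_core hw0 hz₂0 hz₃0 hy0 hm hP h₁ h₂ h₃ h₄ h₅ h₆ hr₂ hr₃ hr₄ hr₅ hr₆
  rw [hfr, ← hadef, ← hLdef]
  refine core.trans ?_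
  have hT : ‖(3 / (2 * (a : ℂ)))‖ = 3 / (2 * a) := by
    rw [show (3 / (2 * (a : ℂ))) = ((3 / (2 * a) : ℝ) : ℂ) by push_cast; ring,
      Complex.norm_real, Real.norm_eq_abs, abs_of_pos (by positivity)]
  rw [hT]
  refine final_bound hL1 hM hC₅₄ (by field_simp; norm_num) (by positivity) hηabs ?_
  have hMa0 : 0 ≤ M * a := mul_nonneg hM ha0.le
  calc 16 * |η| + |ψ| + M * ‖z₂‖ + M * ‖z₃‖ + C₅₄ * a * Real.log L + M * ‖w‖
      ≤ 16 * |η| + (16 * |η| + 4 * a) + M * (3 * a) + M * (2 * a) + C₅₄ * a * L +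
          M * (4 * a) := by gcongr
    _ ≤ 32 * |η| + 4 * a + 9 * (M * a) + C₅₄ * a * L := by linarith

end ResidueEvalMain

end Literature.NumberTheory.LFunctions.Zhang2022.Section7dStatements
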